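import Summits.Ventures.PercRepro.HyperplaneKeyGeneral
import Summits.Ventures.PercRepro.RankLevelSetPlaneTenPrime

/-!
# PercRepro — THE HYPERPLANE KEY AT LEVEL `6`: THE LARGE-CORANK TAILS OF THE ROWS `9 … 21` (p1, gen 42; S3 feeder — p8 owns SUBCLAIM-S3)

`rls_of_hyperplane_key_two_base_of_flat` with the `e`-free flat bounds `f(0 … 6) = 0, 1, 3, 6, 10, 19, 39`
(LocalSparse `2^j − 1` for `j ≤ 2`, PlaneSix, PlaneTen, PlaneTenPrime `19` and `39`) and the exact `Φ(p, 6)`: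
**`RLS M p 6` for every `e`-free `M` of rank `p` on `n ≥ n₀(p)` points, `n₀ = 136 / 138 / 140 / 140 / 142 / 142 / 144 / 146 /
146 / 148 / 150 / 150 / 152` at `p = 9 … 21`** (the cells `(p, d)` with `d ≥ 127 … 131`). Coloops are not excluded. Nothing is
claimed about any cell below these coranks.

* `phiK_<p>_six` — the constants; `flat_six_of_free` — the flat bounds as one function; `c025_core_six_hyperplane_key_<p>`.
Axioms: standard.
-/

open scoped Matroid

namespace PercRepro

namespace HypKey

open Set

variable {α : Type}

/-- The `e`-free flat bounds up to rank `6` as one function: `0, 1, 3, 6, 10, 19, 39`. -/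
theorem flat_six_of_free (M : Matroid α) [M.Finite]
    (hfree : ∀ e ∈ M.E, ∃ A ⊆ M.E \ {e}, e ∉ M.closure A ∧ e ∉ M.closure ((M.E \ {e}) \ A)) :
    ∀ j : ℕ, j ≤ 6 → ∀ X ⊆ M.E, M.eRk X ≤ (j : ℕ∞) → X.ncard ≤
      (if j ≤ 2 then 2 ^ j - 1 else if j = 3 then 6 else if j = 4 then 10 else if j = 5 then 19 else 39) := by
  intro j hj X hX hr
  have hL := ThmN.not_isLoop_of_free M hfree
  interval_cases j
  · simpa using ThmN.ncard_add_one_le_two_pow_of_eRk_le M hL hfree 0 X hX hr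
  · have := ThmN.ncard_add_one_le_two_pow_of_eRk_le M hL hfree 1 X hX hr
    norm_num
    omega
  · have := ThmN.ncard_add_one_le_two_pow_of_eRk_le M hL hfree 2 X hX hr
    norm_num
    omega
  · norm_num
    exact ThmN.ncard_le_six_of_eRk_le_three_of_free M hfree hX (by simpa using hr)
  · norm_num
    exact ThmN.ncard_le_ten_of_eRk_le_four_of_free M hfree hX (by simpa using hr)
  · norm_num
    exact ThmN.ncard_le_nineteen_of_eRk_le_five_of_free M hfree hX (by simpa using hr)
  · norm_num
    exact ThmN.ncard_le_thirtynine_of_eRk_le_six_of_free M hfree hX (by simpa using hr)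

/-- `Φ(9, 6) = 18 / 7`. -/
theorem phiK_nine_six : phiK 9 6 = 18 / 7 := by
  unfold phiK
  rw [show Finset.Ioo 6 9 = Finset.Icc 7 8 by decide]
  norm_num [Finset.sum_Icc_succ_top, Nat.choose]

/-- **The row `p = 9` at level `6` from `n = 136` on** (`d ≥ 127`). -/
theorem c025_core_six_hyperplane_key_nine (M : Matroid α) [M.Finite] (hR : M.eRank = ((9 : ℕ) : ℕ∞))
    (hn : 136 ≤ M.E.ncard)
    (hfree : ∀ e ∈ M.E, ∃ A ⊆ M.E \ {e}, e ∉ M.closure A ∧ e ∉ M.closure ((M.E \ {e}) \ A)) :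
    ThmN.RLS M 9 6 :=
  rls_of_hyperplane_key_two_base_of_flat M 9 6 hR hfree _ (flat_six_of_free M hfree) 136 (by norm_num) hn
    (by rw [phiK_nine_six]; norm_num [Finset.sum_range_succ, Nat.choose])
    (by rw [phiK_nine_six]; norm_num [Finset.sum_range_succ, Nat.choose])

/-- `Φ(10, 6) = 125 / 28`. -/
theorem phiK_ten_six : phiK 10 6 = 125 / 28 := by
  unfold phiK
  rw [show Finset.Ioo 6 10 = Finset.Icc 7 9 by decide]
  norm_num [Finset.sum_Icc_succ_top, Nat.choose]

/-- **The row `p = 10` at level `6` from `n = 138` on** (`d ≥ 128`). -/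
theorem c025_core_six_hyperplane_key_ten (M : Matroid α) [M.Finite] (hR : M.eRank = ((10 : ℕ) : ℕ∞))
    (hn : 138 ≤ M.E.ncard)
    (hfree : ∀ e ∈ M.E, ∃ A ⊆ M.E \ {e}, e ∉ M.closure A ∧ e ∉ M.closure ((M.E \ {e}) \ A)) :
    ThmN.RLS M 10 6 :=
  rls_of_hyperplane_key_two_base_of_flat M 10 6 hR hfree _ (flat_six_of_free M hfree) 138 (by norm_num) hn
    (by rw [phiK_ten_six]; norm_num [Finset.sum_range_succ, Nat.choose])
    (by rw [phiK_ten_six]; norm_num [Finset.sum_range_succ, Nat.choose])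

/-- `Φ(11, 6) = 99 / 14`. -/
theorem phiK_eleven_six : phiK 11 6 = 99 / 14 := by
  unfold phiK
  rw [show Finset.Ioo 6 11 = Finset.Icc 7 10 by decide]
  norm_num [Finset.sum_Icc_succ_top, Nat.choose]

/-- **The row `p = 11` at level `6` from `n = 140` on** (`d ≥ 129`). -/
theorem c025_core_six_hyperplane_key_eleven (M : Matroid α) [M.Finite] (hR : M.eRank = ((11 : ℕ) : ℕ∞))
    (hn : 140 ≤ M.E.ncard)
    (hfree : ∀ e ∈ M.E, ∃ A ⊆ M.E \ {e}, e ∉ M.closure A ∧ e ∉ M.closure ((M.E \ {e}) \ A)) :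
    ThmN.RLS M 11 6 :=
  rls_of_hyperplane_key_two_base_of_flat M 11 6 hR hfree _ (flat_six_of_free M hfree) 140 (by norm_num) hn
    (by rw [phiK_eleven_six]; norm_num [Finset.sum_range_succ, Nat.choose])
    (by rw [phiK_eleven_six]; norm_num [Finset.sum_range_succ, Nat.choose])

/-- `Φ(12, 6) = 226 / 21`. -/
theorem phiK_twelve_six : phiK 12 6 = 226 / 21 := by
  unfold phiK
  rw [show Finset.Ioo 6 12 = Finset.Icc 7 11 by decide]
  norm_num [Finset.sum_Icc_succ_top, Nat.choose]

/-- **The row `p = 12` at level `6` from `n = 140` on** (`d ≥ 128`). -/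
theorem c025_core_six_hyperplane_key_twelve (M : Matroid α) [M.Finite] (hR : M.eRank = ((12 : ℕ) : ℕ∞))
    (hn : 140 ≤ M.E.ncard)
    (hfree : ∀ e ∈ M.E, ∃ A ⊆ M.E \ {e}, e ∉ M.closure A ∧ e ∉ M.closure ((M.E \ {e}) \ A)) :
    ThmN.RLS M 12 6 :=
  rls_of_hyperplane_key_two_base_of_flat M 12 6 hR hfree _ (flat_six_of_free M hfree) 140 (by norm_num) hn
    (by rw [phiK_twelve_six]; norm_num [Finset.sum_range_succ, Nat.choose])
    (by rw [phiK_twelve_six]; norm_num [Finset.sum_range_succ, Nat.choose])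

/-- `Φ(13, 6) = 338 / 21`. -/
theorem phiK_thirteen_six : phiK 13 6 = 338 / 21 := by
  unfold phiK
  rw [show Finset.Ioo 6 13 = Finset.Icc 7 12 by decide]
  norm_num [Finset.sum_Icc_succ_top, Nat.choose]

/-- **The row `p = 13` at level `6` from `n = 142` on** (`d ≥ 129`). -/
theorem c025_core_six_hyperplane_key_thirteen (M : Matroid α) [M.Finite] (hR : M.eRank = ((13 : ℕ) : ℕ∞))
    (hn : 142 ≤ M.E.ncard)
    (hfree : ∀ e ∈ M.E, ∃ A ⊆ M.E \ {e}, e ∉ M.closure A ∧ e ∉ M.closure ((M.E \ {e}) \ A)) :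
    ThmN.RLS M 13 6 :=
  rls_of_hyperplane_key_two_base_of_flat M 13 6 hR hfree _ (flat_six_of_free M hfree) 142 (by norm_num) hn
    (by rw [phiK_thirteen_six]; norm_num [Finset.sum_range_succ, Nat.choose])
    (by rw [phiK_thirteen_six]; norm_num [Finset.sum_range_succ, Nat.choose])

/-- `Φ(14, 6) = 359 / 15`. -/
theorem phiK_fourteen_six : phiK 14 6 = 359 / 15 := by
  unfold phiK
  rw [show Finset.Ioo 6 14 = Finset.Icc 7 13 by decide]
  norm_num [Finset.sum_Icc_succ_top, Nat.choose]

/-- **The row `p = 14` at level `6` from `n = 142` on** (`d ≥ 128`). -/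
theorem c025_core_six_hyperplane_key_fourteen (M : Matroid α) [M.Finite] (hR : M.eRank = ((14 : ℕ) : ℕ∞))
    (hn : 142 ≤ M.E.ncard)
    (hfree : ∀ e ∈ M.E, ∃ A ⊆ M.E \ {e}, e ∉ M.closure A ∧ e ∉ M.closure ((M.E \ {e}) \ A)) :
    ThmN.RLS M 14 6 :=
  rls_of_hyperplane_key_two_base_of_flat M 14 6 hR hfree _ (flat_six_of_free M hfree) 142 (by norm_num) hn
    (by rw [phiK_fourteen_six]; norm_num [Finset.sum_range_succ, Nat.choose])
    (by rw [phiK_fourteen_six]; norm_num [Finset.sum_range_succ, Nat.choose])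

/-- `Φ(15, 6) = 748 / 21`. -/
theorem phiK_fifteen_six : phiK 15 6 = 748 / 21 := by
  unfold phiK
  rw [show Finset.Ioo 6 15 = Finset.Icc 7 14 by decide]
  norm_num [Finset.sum_Icc_succ_top, Nat.choose]

/-- **The row `p = 15` at level `6` from `n = 144` on** (`d ≥ 129`). -/
theorem c025_core_six_hyperplane_key_fifteen (M : Matroid α) [M.Finite] (hR : M.eRank = ((15 : ℕ) : ℕ∞))
    (hn : 144 ≤ M.E.ncard)
    (hfree : ∀ e ∈ M.E, ∃ A ⊆ M.E \ {e}, e ∉ M.closure A ∧ e ∉ M.closure ((M.E \ {e}) \ A)) :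
    ThmN.RLS M 15 6 :=
  rls_of_hyperplane_key_two_base_of_flat M 15 6 hR hfree _ (flat_six_of_free M hfree) 144 (by norm_num) hn
    (by rw [phiK_fifteen_six]; norm_num [Finset.sum_range_succ, Nat.choose])
    (by rw [phiK_fifteen_six]; norm_num [Finset.sum_range_succ, Nat.choose])

/-- `Φ(16, 6) = 12304 / 231`. -/
theorem phiK_sixteen_six : phiK 16 6 = 12304 / 231 := by
  unfold phiK
  rw [show Finset.Ioo 6 16 = Finset.Icc 7 15 by decide]
  norm_num [Finset.sum_Icc_succ_top, Nat.choose]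

/-- **The row `p = 16` at level `6` from `n = 146` on** (`d ≥ 130`). -/
theorem c025_core_six_hyperplane_key_sixteen (M : Matroid α) [M.Finite] (hR : M.eRank = ((16 : ℕ) : ℕ∞))
    (hn : 146 ≤ M.E.ncard)
    (hfree : ∀ e ∈ M.E, ∃ A ⊆ M.E \ {e}, e ∉ M.closure A ∧ e ∉ M.closure ((M.E \ {e}) \ A)) :
    ThmN.RLS M 16 6 :=
  rls_of_hyperplane_key_two_base_of_flat M 16 6 hR hfree _ (flat_six_of_free M hfree) 146 (by norm_num) hn
    (by rw [phiK_sixteen_six]; norm_num [Finset.sum_range_succ, Nat.choose])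
    (by rw [phiK_sixteen_six]; norm_num [Finset.sum_range_succ, Nat.choose])

/-- `Φ(17, 6) = 18530 / 231`. -/
theorem phiK_seventeen_six : phiK 17 6 = 18530 / 231 := by
  unfold phiK
  rw [show Finset.Ioo 6 17 = Finset.Icc 7 16 by decide]
  norm_num [Finset.sum_Icc_succ_top, Nat.choose]

/-- **The row `p = 17` at level `6` from `n = 146` on** (`d ≥ 129`). -/
theorem c025_core_six_hyperplane_key_seventeen (M : Matroid α) [M.Finite] (hR : M.eRank = ((17 : ℕ) : ℕ∞))
    (hn : 146 ≤ M.E.ncard)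
    (hfree : ∀ e ∈ M.E, ∃ A ⊆ M.E \ {e}, e ∉ M.closure A ∧ e ∉ M.closure ((M.E \ {e}) \ A)) :
    ThmN.RLS M 17 6 :=
  rls_of_hyperplane_key_two_base_of_flat M 17 6 hR hfree _ (flat_six_of_free M hfree) 146 (by norm_num) hn
    (by rw [phiK_seventeen_six]; norm_num [Finset.sum_range_succ, Nat.choose])
    (by rw [phiK_seventeen_six]; norm_num [Finset.sum_range_succ, Nat.choose])

/-- `Φ(18, 6) = 18761 / 154`. -/
theorem phiK_eighteen_six : phiK 18 6 = 18761 / 154 := by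
  unfold phiK
  rw [show Finset.Ioo 6 18 = Finset.Icc 7 17 by decide]
  norm_num [Finset.sum_Icc_succ_top, Nat.choose]

/-- **The row `p = 18` at level `6` from `n = 148` on** (`d ≥ 130`). -/
theorem c025_core_six_hyperplane_key_eighteen (M : Matroid α) [M.Finite] (hR : M.eRank = ((18 : ℕ) : ℕ∞))
    (hn : 148 ≤ M.E.ncard)
    (hfree : ∀ e ∈ M.E, ∃ A ⊆ M.E \ {e}, e ∉ M.closure A ∧ e ∉ M.closure ((M.E \ {e}) \ A)) :
    ThmN.RLS M 18 6 :=
  rls_of_hyperplane_key_two_base_of_flat M 18 6 hR hfree _ (flat_six_of_free M hfree) 148 (by norm_num) hn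
    (by rw [phiK_eighteen_six]; norm_num [Finset.sum_range_succ, Nat.choose])
    (by rw [phiK_eighteen_six]; norm_num [Finset.sum_range_succ, Nat.choose])

/-- `Φ(19, 6) = 71877 / 385`. -/
theorem phiK_nineteen_six : phiK 19 6 = 71877 / 385 := by
  unfold phiK
  rw [show Finset.Ioo 6 19 = Finset.Icc 7 18 by decide]
  norm_num [Finset.sum_Icc_succ_top, Nat.choose]

/-- **The row `p = 19` at level `6` from `n = 150` on** (`d ≥ 131`). -/
theorem c025_core_six_hyperplane_key_nineteen (M : Matroid α) [M.Finite] (hR : M.eRank = ((19 : ℕ) : ℕ∞))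
    (hn : 150 ≤ M.E.ncard)
    (hfree : ∀ e ∈ M.E, ∃ A ⊆ M.E \ {e}, e ∉ M.closure A ∧ e ∉ M.closure ((M.E \ {e}) \ A)) :
    ThmN.RLS M 19 6 :=
  rls_of_hyperplane_key_two_base_of_flat M 19 6 hR hfree _ (flat_six_of_free M hfree) 150 (by norm_num) hn
    (by rw [phiK_nineteen_six]; norm_num [Finset.sum_range_succ, Nat.choose])
    (by rw [phiK_nineteen_six]; norm_num [Finset.sum_range_succ, Nat.choose])

/-- `Φ(20, 6) = 289048 / 1001`. -/
theorem phiK_twenty_six : phiK 20 6 = 289048 / 1001 := by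
  unfold phiK
  rw [show Finset.Ioo 6 20 = Finset.Icc 7 19 by decide]
  norm_num [Finset.sum_Icc_succ_top, Nat.choose]

/-- **The row `p = 20` at level `6` from `n = 150` on** (`d ≥ 130`). -/
theorem c025_core_six_hyperplane_key_twenty (M : Matroid α) [M.Finite] (hR : M.eRank = ((20 : ℕ) : ℕ∞))
    (hn : 150 ≤ M.E.ncard)
    (hfree : ∀ e ∈ M.E, ∃ A ⊆ M.E \ {e}, e ∉ M.closure A ∧ e ∉ M.closure ((M.E \ {e}) \ A)) :
    ThmN.RLS M 20 6 :=
  rls_of_hyperplane_key_two_base_of_flat M 20 6 hR hfree _ (flat_six_of_free M hfree) 150 (by norm_num) hn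
    (by rw [phiK_twenty_six]; norm_num [Finset.sum_range_succ, Nat.choose])
    (by rw [phiK_twenty_six]; norm_num [Finset.sum_range_succ, Nat.choose])

/-- `Φ(21, 6) = 193366 / 429`. -/
theorem phiK_twentyone_six : phiK 21 6 = 193366 / 429 := by
  unfold phiK
  rw [show Finset.Ioo 6 21 = Finset.Icc 7 20 by decide]
  norm_num [Finset.sum_Icc_succ_top, Nat.choose]

/-- **The row `p = 21` at level `6` from `n = 152` on** (`d ≥ 131`). -/
theorem c025_core_six_hyperplane_key_twentyone (M : Matroid α) [M.Finite] (hR : M.eRank = ((21 : ℕ) : ℕ∞))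
    (hn : 152 ≤ M.E.ncard)
    (hfree : ∀ e ∈ M.E, ∃ A ⊆ M.E \ {e}, e ∉ M.closure A ∧ e ∉ M.closure ((M.E \ {e}) \ A)) :
    ThmN.RLS M 21 6 :=
  rls_of_hyperplane_key_two_base_of_flat M 21 6 hR hfree _ (flat_six_of_free M hfree) 152 (by norm_num) hn
    (by rw [phiK_twentyone_six]; norm_num [Finset.sum_range_succ, Nat.choose])
    (by rw [phiK_twentyone_six]; norm_num [Finset.sum_range_succ, Nat.choose])

end HypKey

end PercRepro
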